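import Summits.CriticalPhenomena.CardyFormulaZ2.Theorems.CardyIKTransportIKMixedBoxCrossingTransportMonoDefs

/-!
# Stub `stub_arcsIsoGeHon_of` (line `defect-closure-exploration`, reshape v5, crux `IKMixedBoxCrossing`,
# stmt-CriticalPhenomena-5911)

Support file (`--supports stmt-CriticalPhenomena-5911`):
`CylExchange → SlabDeterminacy → LastFaceMono → ArcsIsoGeHon`.

Induction on the number `k` of isotropic face columns at a fixed width `m + 1`.  The face types of a slab of `w`
face columns whose first `k` face columns are isotropic and the others honeycomb are `fun j => decide (j.val < k)`
(all honeycomb for `k = 0`, all isotropic for `k = w`).  For `k ≤ m`,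
`Fin.snoc (fun j : Fin m => decide (j.val < k)) false = fun j : Fin (m + 1) => decide (j.val < k)` on the nose, and
`Fin.snoc (fun j : Fin m => decide (j.val < k)) true` is `fun j : Fin (m + 1) => decide (j.val < k + 1)` precomposed
with the transposition of the face columns `k` and `m`.  Hence `LastFaceMono` (switch the LAST face column from
honeycomb to isotropic) followed by the landed permutation invariance `CylBunchStub.cylArcs_comp_perm` (fed with
`CylExchange` and `SlabDeterminacy`) shows that one more isotropic face column does not decrease `cylArcs`, and
chaining from `k = 0` to `k = m + 1` is `ArcsIsoGeHon` at width `m + 1`; width `0` is trivial (`Fin 0 → Bool` is a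
subsingleton).  No new definitions.
-/

noncomputable section

namespace Summit.CriticalPhenomena.CardyFormulaZ2.Cruxes.IKMixedBoxCrossing.DefectClosureExploration

open scoped BigOperators Classical

namespace ArcsIsoGeHonStub

/-- Appending a honeycomb face column to "first `k` of `m` face columns isotropic" (`k ≤ m`) gives "first `k` of
`m + 1` face columns isotropic". -/
theorem snoc_firstIso_false {m k : ℕ} (hk : k ≤ m) :
    (Fin.snoc (fun j : Fin m => decide (j.val < k)) false : Fin (m + 1) → Bool) =
      fun j : Fin (m + 1) => decide (j.val < k) := by
  funext j
  induction j using Fin.lastCases with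
  | last =>
    rw [Fin.snoc_last, Fin.val_last]
    exact (decide_eq_false (by omega)).symm
  | cast i => rw [Fin.snoc_castSucc, Fin.val_castSucc]

/-- Appending an isotropic face column to "first `k` of `m` face columns isotropic" (`k ≤ m`) gives "first `k + 1`
of `m + 1` face columns isotropic" with the face columns `k` and `m` exchanged. -/
theorem snoc_firstIso_true {m k : ℕ} (hk : k ≤ m) :
    (Fin.snoc (fun j : Fin m => decide (j.val < k)) true : Fin (m + 1) → Bool) =
      (fun j : Fin (m + 1) => decide (j.val < k + 1)) ∘ Equiv.swap (⟨k, by omega⟩ : Fin (m + 1)) (Fin.last m) := by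
  funext j
  induction j using Fin.lastCases with
  | last =>
    rw [Fin.snoc_last, Function.comp_apply, Equiv.swap_apply_right]
    exact (decide_eq_true (by simp)).symm
  | cast i =>
    rw [Fin.snoc_castSucc, Function.comp_apply]
    by_cases hik : i.val = k
    · have h1 : i.castSucc = (⟨k, by omega⟩ : Fin (m + 1)) := Fin.ext (by simp [hik])
      rw [h1, Equiv.swap_apply_left, Fin.val_last, hik]
      exact decide_eq_decide.mpr (by omega)
    · have h1 : i.castSucc ≠ (⟨k, by omega⟩ : Fin (m + 1)) := fun h => hik (by simpa using Fin.ext_iff.mp h)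
      have h2 : i.castSucc ≠ Fin.last m := fun h => by
        have h' := Fin.ext_iff.mp h
        simp only [Fin.val_castSucc, Fin.val_last] at h'
        omega
      rw [Equiv.swap_apply_of_ne_of_ne h1 h2, Fin.val_castSucc]
      exact decide_eq_decide.mpr (by omega)

/-- One more isotropic face column does not decrease the arcs probability: `LastFaceMono` on the last face column,
moved into place by the permutation invariance `CylBunchStub.cylArcs_comp_perm`. -/
theorem cylArcs_firstIso_step (hX : CylExchange) (hD : SlabDeterminacy) (hM : LastFaceMono) {m L : ℕ} [NeZero L]
    (hL : 3 ≤ L) (n k : ℕ) (hk : k ≤ m) :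
    cylArcs (m + 1) L (fun j => decide (j.val < k)) n ≤ cylArcs (m + 1) L (fun j => decide (j.val < k + 1)) n := by
  have h := hM m L n hL (fun j : Fin m => decide (j.val < k))
  rw [snoc_firstIso_false hk, snoc_firstIso_true hk, CylBunchStub.cylArcs_comp_perm hX hD hL n] at h
  exact h

/-- The all-honeycomb arcs probability is at most the one with the first `k ≤ m + 1` face columns isotropic
(induction on `k`, steps `cylArcs_firstIso_step`). -/
theorem cylArcs_allHon_le_firstIso (hX : CylExchange) (hD : SlabDeterminacy) (hM : LastFaceMono) {m L : ℕ}
    [NeZero L] (hL : 3 ≤ L) (n k : ℕ) (hk : k ≤ m + 1) :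
    cylArcs (m + 1) L (fun _ => false) n ≤ cylArcs (m + 1) L (fun j => decide (j.val < k)) n := by
  induction k with
  | zero =>
    exact le_of_eq <| congrArg (fun τ => cylArcs (m + 1) L τ n) <| funext fun j =>
      (decide_eq_false (Nat.not_lt_zero j.val)).symm
  | succ k ih => exact (ih (by omega)).trans (cylArcs_firstIso_step hX hD hM hL n k (by omega))

end ArcsIsoGeHonStub

open ArcsIsoGeHonStub in
/-- **STUB · `stub_arcsIsoGeHon_of`**: `CylExchange → SlabDeterminacy → LastFaceMono → ArcsIsoGeHon`.  Width `0`: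
the two face-type functions `Fin 0 → Bool` coincide.  Width `m + 1`: `cylArcs_allHon_le_firstIso` at `k = m + 1`,
where "first `m + 1` of `m + 1` face columns isotropic" is the all-isotropic slab. -/
theorem stub_arcsIsoGeHon_of : CylExchange → SlabDeterminacy → LastFaceMono → ArcsIsoGeHon := by
  intro hX hD hM w L n _ hL
  cases w with
  | zero => exact le_of_eq <| congrArg (fun τ => cylArcs 0 L τ n) <| funext fun j => j.elim0
  | succ m =>
    calc cylArcs (m + 1) L (fun _ => false) n
        ≤ cylArcs (m + 1) L (fun j => decide (j.val < m + 1)) n :=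
          cylArcs_allHon_le_firstIso hX hD hM hL n (m + 1) le_rfl
      _ = cylArcs (m + 1) L (fun _ => true) n :=
          congrArg (fun τ => cylArcs (m + 1) L τ n) <| funext fun j => decide_eq_true j.isLt

end Summit.CriticalPhenomena.CardyFormulaZ2.Cruxes.IKMixedBoxCrossing.DefectClosureExploration

end
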